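import Mathlib
import HarnessLib
import Literature.Analysis.FluidPDE.Tao2016AveragedNS.LocalCascadeSolutions
import Literature.Analysis.FluidPDE.Tao2016AveragedNS.RenormalisedCascadeWaves
import Literature.Analysis.FluidPDE.Tao2016AveragedNS.WeightedLatticeFlows
import Summits.NavierStokesRegularity.NavierStokesRegularity.Theorems.TaoLadderRungTwoBreakBlowupRigidityOneCriticalLinearisation
import Summits.NavierStokesRegularity.NavierStokesRegularity.Theorems.TaoLadderRungTwoBreakEternalRigidityViscBddOneCriticalRiccati

/-!
# Crux `TaoLadderRungTwoBreak.EternalRigidityViscBddOne` (stmt-NavierStokesRegularity-20420): the BKM-type continuation estimate for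
# the VISCOUS lattice — bounded critical amplitudes keep the (4.5) weight-10 norm bounded (part 2/3 of the viscous minimal blow-up rate)

MODEL lattice ODEs only (Tao 2016 §4: the exact NS-scaled `ν`-viscous cascade lattice `∂ₜX_{i,n} = quadTerm_{i,n}(X) −
ν(1+ε₀)^{2n}X_{i,n}` of a table with bounded structure constants, general `m`); nothing here is a statement about the
Navier–Stokes equations; no stub, crux or summit is closed (`--supports stmt-NavierStokesRegularity-20420`).

THE POINT.  The inviscid `BlowupRigidityOne.CriticalBlowup.weight45_bound_of_critical_bound` (⟨20206⟩) runs Grönwall on the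
supremum of the weight-10 amplitudes, which is Lipschitz along an EXACT flow.  With dissipation the damping `ν(1+ε₀)^{2k}` is
unbounded in the shell, so here every signed amplitude `±(1+(1+ε₀)^{10k})X_{i,k}` is fenced separately against the exponential
`E(τ) = (N+1)e^{K(τ−s)}` (`image_le_of_deriv_right_lt_deriv_boundary`; at a contact point the dissipative part of the derivative is
`−ν(1+ε₀)^{2k}E ≤ 0` and the quadratic part is `≤ m²M_αL(3+(1+ε₀)^{10})·2E < E'` by the linearisation estimate
`weight45_mul_abs_quadTerm_le`), the simultaneous bound on all shells needed at the contact point being supplied by REAL INDUCTION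
(`IsClosed.Icc_subset_of_forall_mem_nhdsWithin`) on «all modes `≤ 2E` so far» — closed by continuity, and open to the right by a
crude LINEAR fence from the window's own (4.5) bound, which is uniform in the shell (no tail argument is available in the weight
that defines the blow-up).

* `weight10_le_exp_of_critical_bound_visc` — **BKM (viscous)**: critical amplitudes `≤ L` on `[s,t] ⊆ [0,T)` and weight-10 amplitudes
  `≤ N` at `s` ⟹ weight-10 amplitudes `≤ (N+1)e^{K(τ−s)}` on `[s,t]`, `K = 2m²M_αL(3+(1+ε₀)^{10}) + 1` (independent of `t`).
Part 3/3 (`…EternalRigidityViscBddOneCriticalRate`): the rate theorem and its reading in the registered vocabulary of the crux.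
HONEST LABEL: (ω3), (ω4), ⟨20420⟩ and every NS statement remain OPEN; rung 0.
-/

noncomputable section

-- the summit and its single sub-problem share the name (CONVENTIONS §1)
set_option linter.dupNamespace false

open Set Filter Topology
open Literature.Analysis.FluidPDE Literature.Analysis.FluidPDE.TaoCascade
open Summit.NavierStokesRegularity.NavierStokesRegularity.Theorems.BlowupRigidityOne

namespace Summit.NavierStokesRegularity.NavierStokesRegularity.Theorems.EternalRigidityViscBddOne.CriticalRate

variable {m : ℕ}

/-! ### The weight-10 (BKM) bound under a critical bound, by real induction -/

/-- **BKM-TYPE CONTINUATION ESTIMATE for the `ν`-viscous lattice.**  Structure constants bounded by `M_α`, `ε₀ > 0`, `ν ≥ 0`.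
Let `X` be a regular trajectory of the exact `ν`-viscous lattice on `[0,T)` (clauses of `ViscousUpTo`: `C¹` on `[0,T)`, one-sided
motion law, (4.5)-regular on every `[0,T']`, `T' < T`).  If on a window `[s,t] ⊆ [0,T)` every CRITICAL amplitude is `≤ L`
(`(1+ε₀)^{5k/2}|X_{i,k}| ≤ L`) and at time `s` every weight-10 amplitude is `≤ N` (`(1+(1+ε₀)^{10k})|X_{i,k}(s)| ≤ N`, `N ≥ 0`),
then on `[s,t]` every weight-10 amplitude is `≤ (N+1)·e^{K(τ−s)}`, `K = 2m²M_αL(3+(1+ε₀)^{10}) + 1` — a bound INDEPENDENT of `t`.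
(Fences `±(1+(1+ε₀)^{10k})X_{i,k} ≤ E` for EVERY shell by the linearisation estimate `weight45_mul_abs_quadTerm_le`; the
dissipation only helps at a contact point; real induction on «all modes `≤ 2E` so far», open to the right by a crude linear fence
from the window's (4.5) bound, uniform in the shell.)
[cite: Teschl2012, §2.6 (continuation of solutions); Tao2016AveragedNS, §4 (4.8), Lemma 4.1 (4.5) and the viscous equation before Thm. 4.2] -/
theorem weight10_le_exp_of_critical_bound_visc {ε₀ ν Mα T L : ℝ} (hε : 0 < ε₀) (hν : 0 ≤ ν) (hMα : 0 ≤ Mα)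
    (hL : 0 ≤ L) {α : Fin m → Fin m → Fin m → ℤ × ℤ × ℤ → ℝ} (hα : ∀ i₁ i₂ i₃ μ, |α i₁ i₂ i₃ μ| ≤ Mα)
    {X : Fin m → ℤ → ℝ → ℝ} (hcd : ∀ i n, ContDiffOn ℝ 1 (X i n) (Ico 0 T))
    (hmot : ∀ i n t, 0 ≤ t → t < T → derivWithin (X i n) (Ici 0) t =
      quadTerm ε₀ α X i n t - ν * (1 + ε₀) ^ ((2 : ℝ) * n) * X i n t)
    (hreg : ∀ T' : ℝ, 0 < T' → T' < T → ∃ M : ℝ, ∀ t : ℝ, 0 ≤ t → t ≤ T' →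
      ∀ (i : Fin m) (n : ℤ), (1 + (1 + ε₀) ^ ((10 : ℝ) * n)) * |X i n t| ≤ M)
    {s t N : ℝ} (hs0 : 0 ≤ s) (hst : s ≤ t) (htT : t < T) (hN : 0 ≤ N)
    (hNs : ∀ (i : Fin m) (k : ℤ), (1 + (1 + ε₀) ^ ((10 : ℝ) * k)) * |X i k s| ≤ N)
    (hcrit : ∀ τ ∈ Icc s t, ∀ (i : Fin m) (k : ℤ), (1 + ε₀) ^ ((5 : ℝ) * k / 2) * |X i k τ| ≤ L) :
    ∀ τ ∈ Icc s t, ∀ (i : Fin m) (k : ℤ),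
      (1 + (1 + ε₀) ^ ((10 : ℝ) * k)) * |X i k τ| ≤
        (N + 1) * Real.exp ((2 * ((m : ℝ) ^ 2 * Mα * L * (3 + (1 + ε₀) ^ (10 : ℝ))) + 1) * (τ - s)) := by
  set C₀ : ℝ := (m : ℝ) ^ 2 * Mα * L * (3 + (1 + ε₀) ^ (10 : ℝ)) with hC₀def
  set K : ℝ := 2 * C₀ + 1 with hKdef
  have hl0 : (0 : ℝ) < 1 + ε₀ := by linarith
  have hC₀0 : 0 ≤ C₀ := by positivity
  have hK0 : 0 < K := by rw [hKdef]; linarith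
  set W : ℤ → ℝ := fun k => 1 + (1 + ε₀) ^ ((10 : ℝ) * k) with hWdef
  have hW0 : ∀ k, 0 < W k := fun k => by
    have := Real.rpow_nonneg hl0.le ((10 : ℝ) * k); simp only [hWdef]; linarith
  -- the exponential boundary `E(τ) = (N+1) e^{K(τ-s)}`
  set E : ℝ → ℝ := fun τ => (N + 1) * Real.exp (K * (τ - s)) with hEdef
  have hEpos : ∀ τ, 0 < E τ := fun τ => mul_pos (by linarith) (Real.exp_pos _)
  have hEat : ∀ τ, HasDerivAt E (K * E τ) τ := fun τ => by
    have h := ((((hasDerivAt_id τ).sub_const s).const_mul K).exp).const_mul (N + 1)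
    refine h.congr_deriv ?_
    simp only [hEdef, mul_one, id]
    ring
  have hEmono : ∀ a b, a ≤ b → E a ≤ E b := fun a b hab =>
    mul_le_mul_of_nonneg_left (Real.exp_le_exp.2 (mul_le_mul_of_nonneg_left (by linarith) hK0.le)) (by linarith)
  have hEs : E s = N + 1 := by simp [hEdef]
  -- the window `[0,T']`, `T' = (t+T)/2`, and its weight-10 bound
  set T' : ℝ := (t + T) / 2 with hT'
  have hT'0 : 0 < T' := by rw [hT']; linarith
  have htT' : t < T' := by rw [hT']; linarith
  have hT'T : T' < T := by rw [hT']; linarith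
  obtain ⟨M₀, hM₀⟩ := hreg T' hT'0 hT'T
  set M : ℝ := max M₀ 0 with hMdef
  have hM0 : 0 ≤ M := le_max_right _ _
  have hM : ∀ τ, 0 ≤ τ → τ ≤ T' → ∀ (i : Fin m) (k : ℤ), W k * |X i k τ| ≤ M :=
    fun τ hτ0 hτT' i k => (hM₀ τ hτ0 hτT' i k).trans (le_max_left _ _)
  clear_value T' M
  -- continuity and right-derivatives of the modes
  have hXc : ∀ (i : Fin m) (k : ℤ), ContinuousOn (X i k) (Icc s t) := fun i k =>
    (hcd i k).continuousOn.mono fun w hw => ⟨hs0.trans hw.1, lt_of_le_of_lt hw.2 htT⟩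
  have hder : ∀ (i : Fin m) (k : ℤ), ∀ τ ∈ Ico s t, HasDerivWithinAt (X i k)
      (quadTerm ε₀ α X i k τ - ν * (1 + ε₀) ^ ((2 : ℝ) * k) * X i k τ) (Ici τ) τ := fun i k τ hτ =>
    hasDerivWithinAt_Ici_of_viscousClauses hcd hmot i k ⟨hs0.trans hτ.1, lt_trans hτ.2 htT⟩
  -- SIGNED FENCE on a sub-window `[a,b] ⊆ [s,t]` against a boundary `Φ` (`Φ' = φ`, positive on `[a,b)`): if all weight-10
  -- amplitudes are `≤ Nv w` at every `w ∈ [a,b)` and `C₀ · Nv w < φ w` there, then `W_k |X_{i,k}| ≤ Φ` on `[a,b]` once it holds at `a`.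
  have hfence : ∀ (a b : ℝ) (Φ φ Nv : ℝ → ℝ), s ≤ a → b ≤ t →
      (∀ w, HasDerivAt Φ (φ w) w) → (∀ w ∈ Ico a b, 0 < Φ w) →
      (∀ w ∈ Ico a b, ∀ (j : Fin m) (k' : ℤ), W k' * |X j k' w| ≤ Nv w) →
      (∀ w ∈ Ico a b, 0 ≤ Nv w) →
      (∀ w ∈ Ico a b, C₀ * Nv w < φ w) →
      ∀ (i : Fin m) (k : ℤ), W k * |X i k a| ≤ Φ a →
        ∀ τ ∈ Icc a b, W k * |X i k τ| ≤ Φ τ := by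
    intro a b Φ φ Nv hsa hbt hΦ hΦpos hNv hNv0 hslope i k hstart τ hτ
    have hsgn : ∀ σ : ℝ, (σ = 1 ∨ σ = -1) → σ * (W k * X i k τ) ≤ Φ τ := by
      intro σ hσ
      have hσ1 : |σ| = 1 := by rcases hσ with rfl | rfl <;> simp
      set f : ℝ → ℝ := fun w => σ * (W k * X i k w) with hfdef
      set f' : ℝ → ℝ := fun w => σ * (W k * (quadTerm ε₀ α X i k w -
        ν * (1 + ε₀) ^ ((2 : ℝ) * k) * X i k w)) with hf'def
      have hfc : ContinuousOn f (Icc a b) :=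
        (continuousOn_const.mul (continuousOn_const.mul ((hXc i k).mono (Icc_subset_Icc hsa hbt))))
      have hfd : ∀ w ∈ Ico a b, HasDerivWithinAt f (f' w) (Ici w) w := fun w hw =>
        ((hder i k w ⟨hsa.trans hw.1, lt_of_lt_of_le hw.2 hbt⟩).const_mul (W k)).const_mul σ
      have hfa : f a ≤ Φ a := by
        calc f a ≤ |f a| := le_abs_self _
          _ = W k * |X i k a| := by
              simp only [hfdef, abs_mul, hσ1, one_mul, abs_of_pos (hW0 k)]
          _ ≤ Φ a := hstart
      have hbound : ∀ w ∈ Ico a b, f w = Φ w → f' w < φ w := by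
        intro w hw hfw
        have hwt : w ∈ Icc s t := ⟨hsa.trans hw.1, hw.2.le.trans hbt⟩
        have hq := weight45_mul_abs_quadTerm_le hε.le hMα hL (hNv0 w hw) hα (hcrit w hwt) (hNv w hw) i k
        have hquad : σ * (W k * quadTerm ε₀ α X i k w) ≤ W k * |quadTerm ε₀ α X i k w| := by
          calc σ * (W k * quadTerm ε₀ α X i k w) ≤ |σ * (W k * quadTerm ε₀ α X i k w)| := le_abs_self _
            _ = W k * |quadTerm ε₀ α X i k w| := by
                rw [abs_mul, hσ1, one_mul, abs_mul, abs_of_pos (hW0 k)]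
        have hf'eq : f' w = σ * (W k * quadTerm ε₀ α X i k w) -
            ν * (1 + ε₀) ^ ((2 : ℝ) * k) * (σ * (W k * X i k w)) := by
          simp only [hf'def]; ring
        -- the dissipative part is `-ν (1+ε₀)^{2k} Φ w ≤ 0`
        have hdis : 0 ≤ ν * (1 + ε₀) ^ ((2 : ℝ) * k) * (σ * (W k * X i k w)) := by
          rw [show σ * (W k * X i k w) = Φ w from hfw]
          exact mul_nonneg (mul_nonneg hν (Real.rpow_nonneg hl0.le _)) (hΦpos w hw).le
        calc f' w ≤ W k * |quadTerm ε₀ α X i k w| := by rw [hf'eq]; linarith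
          _ ≤ C₀ * Nv w := hq
          _ < φ w := hslope w hw
      exact image_le_of_deriv_right_lt_deriv_boundary hfc hfd hfa hΦ hbound hτ
    have h1 := hsgn 1 (Or.inl rfl)
    have h2 := hsgn (-1) (Or.inr rfl)
    rw [one_mul] at h1
    rw [neg_one_mul] at h2
    rw [← abs_of_pos (hW0 k), ← abs_mul]
    exact abs_le.2 ⟨by linarith, h1⟩
  -- BOOTSTRAP: «all modes ≤ 2E on [s,y]» ⇒ «all modes ≤ E on [s,y]»
  have himp : ∀ y ∈ Icc s t, (∀ τ ∈ Icc s y, ∀ (i : Fin m) (k : ℤ), W k * |X i k τ| ≤ 2 * E τ) →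
      ∀ τ ∈ Icc s y, ∀ (i : Fin m) (k : ℤ), W k * |X i k τ| ≤ E τ := by
    intro y hy hweak τ hτ i k
    refine hfence s y E (fun w => K * E w) (fun w => 2 * E w) le_rfl hy.2 hEat (fun w _ => hEpos w)
      (fun w hw j k' => hweak w (Ico_subset_Icc_self hw) j k') (fun w _ => by linarith [hEpos w])
      (fun w _ => ?_) i k (by rw [hEs]; linarith [hNs i k]) τ hτ
    have := hEpos w
    rw [hKdef]; nlinarith
  -- REAL INDUCTION on «all modes ≤ 2E so far» (clamped form)
  set H : Set ℝ := {y | ∀ τ ∈ Icc s t, ∀ (i : Fin m) (k : ℤ),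
      W k * |X i k (min τ y)| ≤ 2 * E (min τ y)} with hH
  have hHweak : ∀ y ∈ Icc s t, y ∈ H → ∀ τ ∈ Icc s y, ∀ (i : Fin m) (k : ℤ),
      W k * |X i k τ| ≤ 2 * E τ := by
    intro y hy hyH τ hτ i k
    have := hyH τ ⟨hτ.1, hτ.2.trans hy.2⟩ i k
    rwa [min_eq_left hτ.2] at this
  have h0H : s ∈ H := by
    intro τ hτ i k
    rw [min_eq_right hτ.1, hEs]
    linarith [hNs i k]
  have hclosed : IsClosed (H ∩ Icc s t) := by
    have hEc : Continuous E := by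
      simp only [hEdef]; fun_prop
    have hlevc : ∀ τ ∈ Icc s t, ∀ (i : Fin m) (k : ℤ),
        ContinuousOn (fun y => W k * |X i k (min τ y)| - 2 * E (min τ y)) (Icc s t) := by
      intro τ hτ i k
      have hmin : ContinuousOn (fun y : ℝ => min τ y) (Icc s t) := (continuous_const.min continuous_id).continuousOn
      have hmaps : MapsTo (fun y : ℝ => min τ y) (Icc s t) (Icc s t) := fun y hy =>
        ⟨le_min hτ.1 hy.1, (min_le_right _ _).trans hy.2⟩
      exact (continuousOn_const.mul (((hXc i k).comp hmin hmaps).abs)).sub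
        (continuousOn_const.mul (hEc.continuousOn.comp hmin hmaps))
    have heq : H ∩ Icc s t = Icc s t ∩ ⋂ τ ∈ Icc s t, ⋂ i : Fin m, ⋂ k : ℤ,
        (Icc s t ∩ (fun y => W k * |X i k (min τ y)| - 2 * E (min τ y)) ⁻¹' Iic 0) := by
      ext y
      simp only [hH, mem_inter_iff, mem_iInter, mem_setOf_eq, mem_preimage, mem_Iic, sub_nonpos]
      constructor
      · rintro ⟨hyH, hy⟩
        exact ⟨hy, fun τ hτ i k => ⟨hy, hyH τ hτ i k⟩⟩
      · rintro ⟨hy, h⟩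
        exact ⟨fun τ hτ i k => (h τ hτ i k).2, hy⟩
    rw [heq]
    exact isClosed_Icc.inter (isClosed_biInter fun τ hτ => isClosed_iInter fun i => isClosed_iInter fun k =>
      (hlevc τ hτ i k).preimage_isClosed_of_isClosed isClosed_Icc isClosed_Iic)
  have hstep : ∀ y ∈ H ∩ Ico s t, H ∈ 𝓝[>] y := by
    rintro y ⟨hyH, hy⟩
    have hyI : y ∈ Icc s t := Ico_subset_Icc_self hy
    have hstrong := himp y hyI (hHweak y hyI hyH)
    have hy0 : 0 ≤ y := hs0.trans hy.1
    -- crude LINEAR fence from `y`, uniform in the shell: `W_k|X_{i,k}(w)| ≤ E y + C''(w - y)` on `[y,t]`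
    set C'' : ℝ := C₀ * M + 1 with hC''
    have hC''0 : 0 < C'' := by rw [hC'']; positivity
    have hlin : ∀ (i : Fin m) (k : ℤ), ∀ w ∈ Icc y t, W k * |X i k w| ≤ E y + C'' * (w - y) := by
      intro i k w hw
      refine hfence y t (fun w => E y + C'' * (w - y)) (fun _ => C'') (fun _ => M) hy.1 le_rfl
        (fun w => ?_) (fun w hw' => by have := hEpos y; nlinarith [hw'.1])
        (fun w hw' j k' => hM w (hy0.trans hw'.1) (hw'.2.le.trans htT'.le) j k')
        (fun _ _ => hM0) (fun _ _ => by rw [hC'']; linarith) i k (by simpa using hstrong y ⟨hy.1, le_rfl⟩ i k) w hw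
      have h := (((hasDerivAt_id w).sub_const y).const_mul C'').const_add (E y)
      simpa using h
    -- the right-neighbourhood `(y, min t (y + E y / C''))`
    have hρ : 0 < E y / C'' := div_pos (hEpos y) hC''0
    have hu : y < min t (y + E y / C'') := lt_min hy.2 (by linarith)
    refine mem_of_superset (Ioo_mem_nhdsGT hu) fun z hz => ?_
    intro τ hτ i k
    rcases le_or_gt (min τ z) y with h | h
    · have := hyH (min τ z) ⟨le_min hτ.1 (hy.1.trans hz.1.le), (min_le_left _ _).trans hτ.2⟩ i k
      rwa [min_eq_left h] at this
    · have hwt : min τ z ≤ t := (min_le_left _ _).trans hτ.2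
      have hwz : min τ z < y + E y / C'' := lt_of_le_of_lt (min_le_right _ _) (lt_of_lt_of_le hz.2 (min_le_right _ _))
      have h1 := hlin i k (min τ z) ⟨h.le, hwt⟩
      have h2 : C'' * (min τ z - y) ≤ E y := by
        rw [← le_div_iff₀' hC''0]; linarith
      have h3 := hEmono y (min τ z) h.le
      linarith
  have hIcc : Icc s t ⊆ H := hclosed.Icc_subset_of_forall_mem_nhdsWithin h0H hstep
  intro τ hτ i k
  exact himp t ⟨hst, le_rfl⟩ (hHweak t ⟨hst, le_rfl⟩ (hIcc ⟨hst, le_rfl⟩)) τ hτ i k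

end Summit.NavierStokesRegularity.NavierStokesRegularity.Theorems.EternalRigidityViscBddOne.CriticalRate

end
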